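import Summits.QuantumFields.YangMills.Theorems.BalabanLadderUVSeamRecWindowFloorsRatio
import Summits.QuantumFields.YangMills.Theorems.BalabanLadderUVSeamRecCeilingsTransfer
import Summits.QuantumFields.YangMills.Theorems.LangevinControlUVOSLegsFromFemtoAndGapStubCollar6
import Summits.QuantumFields.YangMills.Theses.BalabanLadder
import HarnessLib

/-!
# Crux `UVSeamRec` (stmt-QuantumFields-20043): the registered floors stub from WINDOW data (α ≡ ω check-lemma)

Helper file (`--supports stmt-QuantumFields-20043`) of the lead prover (unit `ym-spine-20043-p1`, gen 2), answering the
route owner's check request (ym-beyond-p2 g20, 2026-08-26 13:02:51Z (b) / 13:14:41Z (2)–(3)).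

The registered stub `stub_floorsEngine` of the skeleton of record (`Cruxes/UVSeamRec/Lines/birth.lean`, v3
26c25409080ac510) asks for ONE lattice representation `r` of `SU(2)`, a unit map `a > 0` with `a β / uRec β → c₀ > 0`
(ratio CONVERGENCE), and compactly supported single-scale `Q2` / `|Q3|` floor witnesses at the unit `a`.  The reserve
cut (ω) asked only for a bounded two-sided WINDOW `c₁ ≤ a β / uRec β ≤ c₂` eventually.  This file shows that the
convergence clause is no bottleneck: re-parametrise the unit.  Given window floors at an engine unit `a` (the same
compactly supported witnesses floor `Q2` / `|Q3|` at every smearing scale `a β / t`, `t ∈ [s₁, s₂]`) and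
`s₁ ≤ a β / u β ≤ s₂` eventually, the witnesses floor at the unit `u` ITSELF (`floorsC_of_window`, exact bookkeeping
`WindowTransfer.window_scale`); with `u := c₂ · uRec` the ratio `u / uRec ≡ c₂` converges trivially.  Hence

* `windowFloorsC_of_fcp_ratio` — `FBL ∧ FC2 ∧ FC3` at `a > 0`, `a → 0` ⇒ both window conjuncts over `[κ, 1]` WITH the
  compact support of the bumps recorded (re-bundling of the landed `windowFloors_twoPoint_ratio` /
  `windowFloors_threePoint_ratio`);
* `floorsC_of_fcp_commensurable` — … + `c₁ ≤ a β / u β ≤ c₂` eventually (`0 < c₁ ≤ c₂`, `0 < u`) ⇒ compact single-scale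
  floors at the unit `c₂ · u`;
* `floorsEngine_of_fcp_commensurable` — with `u := uRec`: the `heng` data of `UnitTransfer.stubFloors_of_engine` for `r`
  (unit `c₂ · uRec`, `c₀ := c₂`);
* `stubFloorsEngine_of_cfpWindow` — skeleton shape (`SU(2)`, Borel): CFP-type window data
  `∃ r a c₁ c₂, 0 < c₁ ≤ c₂ ∧ 0 < a ∧ a → 0 ∧ (∀ᶠ β, c₁ ≤ a/uRec ≤ c₂) ∧ FBL ∧ FC2 ∧ FC3` ⇒ THE REGISTERED
  `stub_floorsEngine` STATEMENT VERBATIM; `stubFloorsEngine_of_cfpWindow'` drops the (derivable) clause `a → 0`;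
* `momentBounds6_uRec_of_fbl6_commensurable` — ceilings side on the same data: `FBL6` at `a`, `a ≤ c · uRec` eventually
  ⇒ `MomentBounds6` at `uRec` (landed `stub_collar6` + `CeilingsTransfer.momentBounds6_of_eventually_le`);
* `uvSeamRecBody_of_cfp6Window`, `uvSeamRec_of_cfp6Window` — the seam body / the route decl (its `UV` hypothesis UNUSED)
  from CFP6-type window data `FBL6 ∧ FC2 ∧ FC3` at a unit commensurate with `uRec` (the femto discharge path re-based on
  conditional-package data, owner 13:01:48Z (5); `IsCompactSimpleLieGroup SU(2)` is not even needed here).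

Consequence for the registry (owner's reading): every engine delivering window floors + a bounded unit ratio feeds the
registered (α) stub as typed, so (α) ≡ (ω) in feedability and v3 stands.
-/

set_option autoImplicit false

noncomputable section

open scoped SchwartzMap
open MeasureTheory Filter Topology
open Literature.MathematicalPhysics.QuantumFieldTheory Literature.MathematicalPhysics.QuantumLattice
open Summit.QuantumFields.YangMills.Cruxes.OSLegsFromFemtoAndGap.DlrCollarTransfer

namespace Summit.QuantumFields.YangMills.Cruxes.UVSeamRec.FloorsEngineOfWindow

section Generic

variable {G : Type} [Group G] [TopologicalSpace G] [IsTopologicalGroup G] [CompactSpace G]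
  [MeasurableSpace G] [BorelSpace G]

/-- **Single-scale compact floors from window floors** (exact bookkeeping).  If compactly supported witnesses floor
`Q2(θv, v)` and `|Q3(f, g, h)|` at every smearing scale `a β / s`, `s ∈ [s₁, s₂]` (`0 < s₁`), uniformly, and
`s₁ ≤ a β / u β ≤ s₂` eventually (`0 < u`), then the SAME witnesses floor at the unit `u`. [folklore] -/
theorem floorsC_of_window (r : LatticeRep G) {a u : ℝ → ℝ} {s₁ s₂ : ℝ} (hs₁ : 0 < s₁) (hu : ∀ β, 0 < u β)
    (hwin : ∀ᶠ β in atTop, s₁ ≤ a β / u β ∧ a β / u β ≤ s₂)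
    (h2 : ∃ (v : 𝓢(EuclideanSpace ℝ (Fin 4), ℝ)) (ε β₅ Λ₅ : ℝ),
      HasCompactSupport (v : EuclideanSpace ℝ (Fin 4) → ℝ) ∧
      tsupport (v : EuclideanSpace ℝ (Fin 4) → ℝ) ⊆ {y : EuclideanSpace ℝ (Fin 4) | 0 < y 0} ∧ 0 < ε ∧
      ∀ s ∈ Set.Icc s₁ s₂, ∀ β : ℝ, β₅ ≤ β → ∀ L : ℕ, Λ₅ ≤ a β * L →
        ε ≤ Q2 G r β L (a β / s) (thetaTest 4 v) v)
    (h3 : ∃ (f g h : 𝓢(EuclideanSpace ℝ (Fin 4), ℝ)) (ε β₅ Λ₅ : ℝ),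
      HasCompactSupport (f : EuclideanSpace ℝ (Fin 4) → ℝ) ∧ HasCompactSupport (g : EuclideanSpace ℝ (Fin 4) → ℝ) ∧
      HasCompactSupport (h : EuclideanSpace ℝ (Fin 4) → ℝ) ∧
      Disjoint (tsupport (f : EuclideanSpace ℝ (Fin 4) → ℝ)) (tsupport (g : EuclideanSpace ℝ (Fin 4) → ℝ)) ∧
      Disjoint (tsupport (g : EuclideanSpace ℝ (Fin 4) → ℝ)) (tsupport (h : EuclideanSpace ℝ (Fin 4) → ℝ)) ∧
      Disjoint (tsupport (f : EuclideanSpace ℝ (Fin 4) → ℝ)) (tsupport (h : EuclideanSpace ℝ (Fin 4) → ℝ)) ∧ 0 < ε ∧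
      ∀ s ∈ Set.Icc s₁ s₂, ∀ β : ℝ, β₅ ≤ β → ∀ L : ℕ, Λ₅ ≤ a β * L → ε ≤ |Q3 G r β L (a β / s) f g h|) :
    (∃ (v : 𝓢(EuclideanSpace ℝ (Fin 4), ℝ)) (ε β₅ Λ₅ : ℝ),
      HasCompactSupport (v : EuclideanSpace ℝ (Fin 4) → ℝ) ∧
      tsupport (v : EuclideanSpace ℝ (Fin 4) → ℝ) ⊆ {y : EuclideanSpace ℝ (Fin 4) | 0 < y 0} ∧ 0 < ε ∧
      ∀ β : ℝ, β₅ ≤ β → ∀ L : ℕ, Λ₅ ≤ u β * L → ε ≤ Q2 G r β L (u β) (thetaTest 4 v) v) ∧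
    (∃ (f g h : 𝓢(EuclideanSpace ℝ (Fin 4), ℝ)) (ε β₅ Λ₅ : ℝ),
      HasCompactSupport (f : EuclideanSpace ℝ (Fin 4) → ℝ) ∧ HasCompactSupport (g : EuclideanSpace ℝ (Fin 4) → ℝ) ∧
      HasCompactSupport (h : EuclideanSpace ℝ (Fin 4) → ℝ) ∧
      Disjoint (tsupport (f : EuclideanSpace ℝ (Fin 4) → ℝ)) (tsupport (g : EuclideanSpace ℝ (Fin 4) → ℝ)) ∧
      Disjoint (tsupport (g : EuclideanSpace ℝ (Fin 4) → ℝ)) (tsupport (h : EuclideanSpace ℝ (Fin 4) → ℝ)) ∧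
      Disjoint (tsupport (f : EuclideanSpace ℝ (Fin 4) → ℝ)) (tsupport (h : EuclideanSpace ℝ (Fin 4) → ℝ)) ∧ 0 < ε ∧
      ∀ β : ℝ, β₅ ≤ β → ∀ L : ℕ, Λ₅ ≤ u β * L → ε ≤ |Q3 G r β L (u β) f g h|) := by
  obtain ⟨β₀, hβ₀⟩ := Filter.eventually_atTop.1 hwin
  obtain ⟨v, ε, β₅, Λ₅, hvc, hv, hε, H2⟩ := h2
  obtain ⟨f, g, h, ε', β₅', Λ₅', hfc, hgc, hhc, hfg, hgh, hfh, hε', H3⟩ := h3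
  refine ⟨⟨v, ε, max β₅ β₀, max Λ₅ 0 / s₁, hvc, hv, hε, fun β hβ L hL => ?_⟩,
    ⟨f, g, h, ε', max β₅' β₀, max Λ₅' 0 / s₁, hfc, hgc, hhc, hfg, hgh, hfh, hε', fun β hβ L hL => ?_⟩⟩
  · obtain ⟨hwlo, hwhi⟩ := hβ₀ β ((le_max_right _ _).trans hβ)
    obtain ⟨hmem, heq, hΛ⟩ := WindowTransfer.window_scale hs₁ (hu β) hwlo hwhi hL
    have := H2 (a β / u β) hmem β ((le_max_left _ _).trans hβ) L ((le_max_left _ _).trans hΛ)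
    rwa [heq] at this
  · obtain ⟨hwlo, hwhi⟩ := hβ₀ β ((le_max_right _ _).trans hβ)
    obtain ⟨hmem, heq, hΛ⟩ := WindowTransfer.window_scale hs₁ (hu β) hwlo hwhi hL
    have := H3 (a β / u β) hmem β ((le_max_left _ _).trans hβ) L ((le_max_left _ _).trans hΛ)
    rwa [heq] at this

/-- **Scale-window floors from the frozen-boundary femto package, ratio `κ`, compact support RECORDED**: from
`FBL ∧ FC2 ∧ FC3` at `a > 0`, `a → 0`, ONE compactly supported positive-time bump floors `Q2(θv, v)` and ONE triple of
compactly supported pairwise disjoint bumps floors `|Q3(f, g, h)|` at every smearing scale `a β / t`, `t ∈ [κ, 1]`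
(the landed `WindowFloors.windowFloors_twoPoint_ratio` / `windowFloors_threePoint_ratio`, re-bundled). [folklore] -/
theorem windowFloorsC_of_fcp_ratio (r : LatticeRep G) (a : ℝ → ℝ) {κ : ℝ} (hκ : 0 < κ) (hapos : ∀ β, 0 < a β)
    (hlim : Tendsto a atTop (𝓝 0)) (hFBL : FBL G r a) (hFC2 : FC2 G r a) (hFC3 : FC3 G r a) :
    (∃ (v : 𝓢(EuclideanSpace ℝ (Fin 4), ℝ)) (ε β₅ Λ₅ : ℝ),
      HasCompactSupport (v : EuclideanSpace ℝ (Fin 4) → ℝ) ∧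
      tsupport (v : EuclideanSpace ℝ (Fin 4) → ℝ) ⊆ {y : EuclideanSpace ℝ (Fin 4) | 0 < y 0} ∧ 0 < ε ∧
      ∀ t ∈ Set.Icc κ 1, ∀ β : ℝ, β₅ ≤ β → ∀ L : ℕ, Λ₅ ≤ a β * L →
        ε ≤ Q2 G r β L (a β / t) (thetaTest 4 v) v) ∧
    (∃ (f g h : 𝓢(EuclideanSpace ℝ (Fin 4), ℝ)) (ε β₅ Λ₅ : ℝ),
      HasCompactSupport (f : EuclideanSpace ℝ (Fin 4) → ℝ) ∧ HasCompactSupport (g : EuclideanSpace ℝ (Fin 4) → ℝ) ∧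
      HasCompactSupport (h : EuclideanSpace ℝ (Fin 4) → ℝ) ∧
      Disjoint (tsupport (f : EuclideanSpace ℝ (Fin 4) → ℝ)) (tsupport (g : EuclideanSpace ℝ (Fin 4) → ℝ)) ∧
      Disjoint (tsupport (g : EuclideanSpace ℝ (Fin 4) → ℝ)) (tsupport (h : EuclideanSpace ℝ (Fin 4) → ℝ)) ∧
      Disjoint (tsupport (f : EuclideanSpace ℝ (Fin 4) → ℝ)) (tsupport (h : EuclideanSpace ℝ (Fin 4) → ℝ)) ∧ 0 < ε ∧
      ∀ t ∈ Set.Icc κ 1, ∀ β : ℝ, β₅ ≤ β → ∀ L : ℕ, Λ₅ ≤ a β * L → ε ≤ |Q3 G r β L (a β / t) f g h|) :=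
  ⟨WindowFloors.windowFloors_twoPoint_ratio G r a hκ hapos hlim hFBL hFC2,
    WindowFloors.windowFloors_threePoint_ratio G r a hκ hapos hlim hFBL hFC2 hFC3⟩

/-- The window `c₁ ≤ a/u ≤ c₂` for the unit `u` is the window `[c₁/c₂, 1]` for the unit `c₂ · u`. [folklore] -/
theorem eventually_window_const_mul {a u : ℝ → ℝ} {c₁ c₂ : ℝ} (hc₂ : 0 < c₂) (hu : ∀ β, 0 < u β)
    (hwin : ∀ᶠ β in atTop, c₁ ≤ a β / u β ∧ a β / u β ≤ c₂) :
    ∀ᶠ β in atTop, c₁ / c₂ ≤ a β / (c₂ * u β) ∧ a β / (c₂ * u β) ≤ 1 := by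
  filter_upwards [hwin] with β hβ
  obtain ⟨h1, h2⟩ := hβ
  have huβ := hu β
  have e : a β / (c₂ * u β) = a β / u β / c₂ := by
    field_simp
  rw [e]
  exact ⟨div_le_div_of_nonneg_right h1 hc₂.le, (div_le_one hc₂).2 h2⟩

/-- **Compact single-scale floors at a commensurate unit from the femto package.**  `FBL ∧ FC2 ∧ FC3` at `a > 0`,
`a → 0`, and ANY bounded two-sided window `c₁ ≤ a β / u β ≤ c₂` eventually (`0 < c₁ ≤ c₂`, `0 < u`) give compactly
supported `Q2` / `|Q3|` floor witnesses at the unit `c₂ · u` (window floors over `[c₁/c₂, 1]`, then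
`floorsC_of_window`).  No ceilings, no convergence of the unit ratio. [folklore] -/
theorem floorsC_of_fcp_commensurable (r : LatticeRep G) (a : ℝ → ℝ) {u : ℝ → ℝ} {c₁ c₂ : ℝ} (hc₁ : 0 < c₁)
    (hc₁₂ : c₁ ≤ c₂) (hapos : ∀ β, 0 < a β) (hlim : Tendsto a atTop (𝓝 0)) (hu : ∀ β, 0 < u β)
    (hwin : ∀ᶠ β in atTop, c₁ ≤ a β / u β ∧ a β / u β ≤ c₂)
    (hFBL : FBL G r a) (hFC2 : FC2 G r a) (hFC3 : FC3 G r a) :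
    (∃ (v : 𝓢(EuclideanSpace ℝ (Fin 4), ℝ)) (ε β₅ Λ₅ : ℝ),
      HasCompactSupport (v : EuclideanSpace ℝ (Fin 4) → ℝ) ∧
      tsupport (v : EuclideanSpace ℝ (Fin 4) → ℝ) ⊆ {y : EuclideanSpace ℝ (Fin 4) | 0 < y 0} ∧ 0 < ε ∧
      ∀ β : ℝ, β₅ ≤ β → ∀ L : ℕ, Λ₅ ≤ c₂ * u β * L → ε ≤ Q2 G r β L (c₂ * u β) (thetaTest 4 v) v) ∧
    (∃ (f g h : 𝓢(EuclideanSpace ℝ (Fin 4), ℝ)) (ε β₅ Λ₅ : ℝ),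
      HasCompactSupport (f : EuclideanSpace ℝ (Fin 4) → ℝ) ∧ HasCompactSupport (g : EuclideanSpace ℝ (Fin 4) → ℝ) ∧
      HasCompactSupport (h : EuclideanSpace ℝ (Fin 4) → ℝ) ∧
      Disjoint (tsupport (f : EuclideanSpace ℝ (Fin 4) → ℝ)) (tsupport (g : EuclideanSpace ℝ (Fin 4) → ℝ)) ∧
      Disjoint (tsupport (g : EuclideanSpace ℝ (Fin 4) → ℝ)) (tsupport (h : EuclideanSpace ℝ (Fin 4) → ℝ)) ∧
      Disjoint (tsupport (f : EuclideanSpace ℝ (Fin 4) → ℝ)) (tsupport (h : EuclideanSpace ℝ (Fin 4) → ℝ)) ∧ 0 < ε ∧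
      ∀ β : ℝ, β₅ ≤ β → ∀ L : ℕ, Λ₅ ≤ c₂ * u β * L → ε ≤ |Q3 G r β L (c₂ * u β) f g h|) := by
  have hc₂ : 0 < c₂ := hc₁.trans_le hc₁₂
  obtain ⟨h2, h3⟩ := windowFloorsC_of_fcp_ratio r a (div_pos hc₁ hc₂) hapos hlim hFBL hFC2 hFC3
  exact floorsC_of_window (u := fun β => c₂ * u β) r (div_pos hc₁ hc₂) (fun β => mul_pos hc₂ (hu β))
    (eventually_window_const_mul hc₂ hu hwin) h2 h3

/-- A positive unit map inside a bounded window above a unit tending to `0` tends to `0`. [folklore] -/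
theorem tendsto_zero_of_window {a u : ℝ → ℝ} {c₂ : ℝ} (hapos : ∀ β, 0 < a β) (hu : ∀ β, 0 < u β)
    (hulim : Tendsto u atTop (𝓝 0)) (hwin : ∀ᶠ β in atTop, a β / u β ≤ c₂) : Tendsto a atTop (𝓝 0) := by
  have hle : ∀ᶠ β in atTop, a β ≤ c₂ * u β := by
    filter_upwards [hwin] with β hβ
    have := (div_le_iff₀ (hu β)).1 hβ
    linarith
  have hcu : Tendsto (fun β => c₂ * u β) atTop (𝓝 0) := by
    simpa using hulim.const_mul c₂
  exact tendsto_of_tendsto_of_tendsto_of_le_of_le' tendsto_const_nhds hcu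
    (Filter.Eventually.of_forall fun β => (hapos β).le) hle

/-- **The `heng` data of the registered floors stub from the femto package at a commensurate unit** (generic `G`):
`FBL ∧ FC2 ∧ FC3` at `a > 0`, `a → 0`, `c₁ ≤ a β / uRec β ≤ c₂` eventually (`0 < c₁ ≤ c₂`) ⇒ a unit `a' > 0` with
`a' β / uRec β → c₀ > 0` carrying compactly supported single-scale `Q2` / `|Q3|` floors — namely `a' := c₂ · uRec`,
`c₀ := c₂` (re-parametrisation of the unit; the ratio converges trivially). [folklore] -/
theorem floorsEngine_of_fcp_commensurable (r : LatticeRep G) (a : ℝ → ℝ) {c₁ c₂ : ℝ} (hc₁ : 0 < c₁) (hc₁₂ : c₁ ≤ c₂)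
    (hapos : ∀ β, 0 < a β) (hlim : Tendsto a atTop (𝓝 0))
    (hwin : ∀ᶠ β in atTop, c₁ ≤ a β / Transport.uRec β ∧ a β / Transport.uRec β ≤ c₂)
    (hFBL : FBL G r a) (hFC2 : FC2 G r a) (hFC3 : FC3 G r a) :
    ∃ (a' : ℝ → ℝ) (c₀ : ℝ), 0 < c₀ ∧ (∀ β, 0 < a' β) ∧
      Tendsto (fun β => a' β / Transport.uRec β) atTop (𝓝 c₀) ∧
      (∃ (v : 𝓢(EuclideanSpace ℝ (Fin 4), ℝ)) (ε β₅ Λ₅ : ℝ),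
        HasCompactSupport (v : EuclideanSpace ℝ (Fin 4) → ℝ) ∧
        tsupport (v : EuclideanSpace ℝ (Fin 4) → ℝ) ⊆ {y : EuclideanSpace ℝ (Fin 4) | 0 < y 0} ∧ 0 < ε ∧
        ∀ β : ℝ, β₅ ≤ β → ∀ L : ℕ, Λ₅ ≤ a' β * L → ε ≤ Q2 G r β L (a' β) (thetaTest 4 v) v) ∧
      (∃ (f g h : 𝓢(EuclideanSpace ℝ (Fin 4), ℝ)) (ε β₅ Λ₅ : ℝ),
        HasCompactSupport (f : EuclideanSpace ℝ (Fin 4) → ℝ) ∧ HasCompactSupport (g : EuclideanSpace ℝ (Fin 4) → ℝ) ∧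
        HasCompactSupport (h : EuclideanSpace ℝ (Fin 4) → ℝ) ∧
        Disjoint (tsupport (f : EuclideanSpace ℝ (Fin 4) → ℝ)) (tsupport (g : EuclideanSpace ℝ (Fin 4) → ℝ)) ∧
        Disjoint (tsupport (g : EuclideanSpace ℝ (Fin 4) → ℝ)) (tsupport (h : EuclideanSpace ℝ (Fin 4) → ℝ)) ∧
        Disjoint (tsupport (f : EuclideanSpace ℝ (Fin 4) → ℝ)) (tsupport (h : EuclideanSpace ℝ (Fin 4) → ℝ)) ∧ 0 < ε ∧
        ∀ β : ℝ, β₅ ≤ β → ∀ L : ℕ, Λ₅ ≤ a' β * L → ε ≤ |Q3 G r β L (a' β) f g h|) := by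
  have hc₂ : 0 < c₂ := hc₁.trans_le hc₁₂
  obtain ⟨h2, h3⟩ := floorsC_of_fcp_commensurable r a hc₁ hc₁₂ hapos hlim UnitTransfer.uRec_pos hwin hFBL hFC2 hFC3
  refine ⟨fun β => c₂ * Transport.uRec β, c₂, hc₂, fun β => mul_pos hc₂ (UnitTransfer.uRec_pos β), ?_, h2, h3⟩
  refine tendsto_const_nhds.congr' (Filter.Eventually.of_forall fun β => ?_)
  exact (mul_div_cancel_right₀ c₂ (UnitTransfer.uRec_pos β).ne').symm

/-- **Ceilings at the unit of record from the plane-resolved boundary law at a commensurate unit** (generic `G`):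
`FBL6 G r a` and `a ≤ c · uRec` eventually (`0 < c`) ⇒ `MomentBounds6 G r uRec` (landed `stub_collar6` + the one-sided
transport `CeilingsTransfer.momentBounds6_of_eventually_le`). [folklore] -/
theorem momentBounds6_uRec_of_fbl6_commensurable (r : LatticeRep G) {a : ℝ → ℝ} {c : ℝ} (hc : 0 < c)
    (hle : ∀ᶠ β in atTop, a β ≤ c * Transport.uRec β) (hFBL6 : FBL6 G r a) :
    MomentBounds6 G r Transport.uRec :=
  CeilingsTransfer.momentBounds6_of_eventually_le r hc hle (stub_collar6 G r a hFBL6)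

/-- The upper half of a window gives the one-sided comparison `a ≤ c₂ · uRec` eventually. [folklore] -/
theorem eventually_le_of_window {a : ℝ → ℝ} {c₁ c₂ : ℝ}
    (hwin : ∀ᶠ β in atTop, c₁ ≤ a β / Transport.uRec β ∧ a β / Transport.uRec β ≤ c₂) :
    ∀ᶠ β in atTop, a β ≤ c₂ * Transport.uRec β := by
  filter_upwards [hwin] with β hβ
  exact (div_le_iff₀ (UnitTransfer.uRec_pos β)).1 hβ.2

/-- **Both legs of the seam at the unit of record from CFP6-type window data** (generic `G`): `FBL6 ∧ FC2 ∧ FC3` at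
`a > 0`, `a → 0`, `c₁ ≤ a β / uRec β ≤ c₂` eventually (`0 < c₁ ≤ c₂`) ⇒ `LowerBounds G r uRec ∧ MomentBounds6 G r uRec`
(floors by the window route `WindowFloors.lowerBounds_of_fcp_commensurable'` through `fbl_of_fbl6`; ceilings by
`momentBounds6_uRec_of_fbl6_commensurable`). [folklore] -/
theorem seamLegs_uRec_of_cfp6_commensurable (r : LatticeRep G) (a : ℝ → ℝ) {c₁ c₂ : ℝ} (hc₁ : 0 < c₁)
    (hc₁₂ : c₁ ≤ c₂) (hapos : ∀ β, 0 < a β) (hlim : Tendsto a atTop (𝓝 0))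
    (hwin : ∀ᶠ β in atTop, c₁ ≤ a β / Transport.uRec β ∧ a β / Transport.uRec β ≤ c₂)
    (hFBL6 : FBL6 G r a) (hFC2 : FC2 G r a) (hFC3 : FC3 G r a) :
    LowerBounds G r Transport.uRec ∧ MomentBounds6 G r Transport.uRec :=
  ⟨WindowFloors.lowerBounds_of_fcp_commensurable' G r a hc₁ hc₁₂ hapos hlim UnitTransfer.uRec_pos hwin
      (fbl_of_fbl6 r a hFBL6) hFC2 hFC3,
    momentBounds6_uRec_of_fbl6_commensurable r (hc₁.trans_le hc₁₂) (eventually_le_of_window hwin) hFBL6⟩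

end Generic

/-! ## Skeleton-shaped statements (`SU(2)`, Borel σ-algebra) -/

/-- **CHECK-LEMMA (α ≡ ω): the REGISTERED `stub_floorsEngine` statement from CFP-type window data.**  ONE lattice
representation of `SU(2)` carrying the frozen-boundary femto package `FBL ∧ FC2 ∧ FC3` at a unit `a > 0`, `a → 0`, that
is two-loop-commensurate with the unit of record UP TO BOUNDED FACTORS (`c₁ ≤ a β / uRec β ≤ c₂` eventually,
`0 < c₁ ≤ c₂`) ⇒ the statement of the registered stub `stub_floorsEngine` of `Cruxes/UVSeamRec/Lines/birth.lean` (v3)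
verbatim, with witnesses `(r, c₂ · uRec, c₀ := c₂)`.  No ceilings, no `UV`, no convergence assumed. [folklore] -/
theorem stubFloorsEngine_of_cfpWindow
    (hcfp : letI : MeasurableSpace (Matrix.specialUnitaryGroup (Fin 2) ℂ) := borel _
      haveI : BorelSpace (Matrix.specialUnitaryGroup (Fin 2) ℂ) := ⟨rfl⟩
      ∃ (r : LatticeRep (Matrix.specialUnitaryGroup (Fin 2) ℂ)) (a : ℝ → ℝ) (c₁ c₂ : ℝ), 0 < c₁ ∧ c₁ ≤ c₂ ∧
        (∀ β, 0 < a β) ∧ Tendsto a atTop (𝓝 0) ∧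
        (∀ᶠ β in atTop, c₁ ≤ a β / Transport.uRec β ∧ a β / Transport.uRec β ≤ c₂) ∧
        FBL (Matrix.specialUnitaryGroup (Fin 2) ℂ) r a ∧ FC2 (Matrix.specialUnitaryGroup (Fin 2) ℂ) r a ∧
        FC3 (Matrix.specialUnitaryGroup (Fin 2) ℂ) r a) :
    letI : MeasurableSpace (Matrix.specialUnitaryGroup (Fin 2) ℂ) := borel _
    haveI : BorelSpace (Matrix.specialUnitaryGroup (Fin 2) ℂ) := ⟨rfl⟩
    ∃ (r : LatticeRep (Matrix.specialUnitaryGroup (Fin 2) ℂ)) (a : ℝ → ℝ) (c₀ : ℝ), 0 < c₀ ∧ (∀ β, 0 < a β) ∧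
      Tendsto (fun β => a β / Transport.uRec β) atTop (𝓝 c₀) ∧
      (∃ (v : 𝓢(EuclideanSpace ℝ (Fin 4), ℝ)) (ε β₅ Λ₅ : ℝ),
        HasCompactSupport (v : EuclideanSpace ℝ (Fin 4) → ℝ) ∧
        tsupport (v : EuclideanSpace ℝ (Fin 4) → ℝ) ⊆ {y : EuclideanSpace ℝ (Fin 4) | 0 < y 0} ∧ 0 < ε ∧
        ∀ β : ℝ, β₅ ≤ β → ∀ L : ℕ, Λ₅ ≤ a β * L →
          ε ≤ Q2 (Matrix.specialUnitaryGroup (Fin 2) ℂ) r β L (a β) (thetaTest 4 v) v) ∧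
      (∃ (f g h : 𝓢(EuclideanSpace ℝ (Fin 4), ℝ)) (ε β₅ Λ₅ : ℝ),
        HasCompactSupport (f : EuclideanSpace ℝ (Fin 4) → ℝ) ∧
        HasCompactSupport (g : EuclideanSpace ℝ (Fin 4) → ℝ) ∧
        HasCompactSupport (h : EuclideanSpace ℝ (Fin 4) → ℝ) ∧
        Disjoint (tsupport (f : EuclideanSpace ℝ (Fin 4) → ℝ)) (tsupport (g : EuclideanSpace ℝ (Fin 4) → ℝ)) ∧
        Disjoint (tsupport (g : EuclideanSpace ℝ (Fin 4) → ℝ)) (tsupport (h : EuclideanSpace ℝ (Fin 4) → ℝ)) ∧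
        Disjoint (tsupport (f : EuclideanSpace ℝ (Fin 4) → ℝ)) (tsupport (h : EuclideanSpace ℝ (Fin 4) → ℝ)) ∧
        0 < ε ∧ ∀ β : ℝ, β₅ ≤ β → ∀ L : ℕ, Λ₅ ≤ a β * L →
          ε ≤ |Q3 (Matrix.specialUnitaryGroup (Fin 2) ℂ) r β L (a β) f g h|) := by
  letI : MeasurableSpace (Matrix.specialUnitaryGroup (Fin 2) ℂ) := borel _
  haveI : BorelSpace (Matrix.specialUnitaryGroup (Fin 2) ℂ) := ⟨rfl⟩
  obtain ⟨r, a, c₁, c₂, hc₁, hc₁₂, hapos, hlim, hwin, hFBL, hFC2, hFC3⟩ := hcfp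
  exact ⟨r, floorsEngine_of_fcp_commensurable r a hc₁ hc₁₂ hapos hlim hwin hFBL hFC2 hFC3⟩

/-- **The same check-lemma without the clause `a → 0`** (it follows from the window and `uRec → 0`). [folklore] -/
theorem stubFloorsEngine_of_cfpWindow'
    (hcfp : letI : MeasurableSpace (Matrix.specialUnitaryGroup (Fin 2) ℂ) := borel _
      haveI : BorelSpace (Matrix.specialUnitaryGroup (Fin 2) ℂ) := ⟨rfl⟩
      ∃ (r : LatticeRep (Matrix.specialUnitaryGroup (Fin 2) ℂ)) (a : ℝ → ℝ) (c₁ c₂ : ℝ), 0 < c₁ ∧ c₁ ≤ c₂ ∧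
        (∀ β, 0 < a β) ∧
        (∀ᶠ β in atTop, c₁ ≤ a β / Transport.uRec β ∧ a β / Transport.uRec β ≤ c₂) ∧
        FBL (Matrix.specialUnitaryGroup (Fin 2) ℂ) r a ∧ FC2 (Matrix.specialUnitaryGroup (Fin 2) ℂ) r a ∧
        FC3 (Matrix.specialUnitaryGroup (Fin 2) ℂ) r a) :
    letI : MeasurableSpace (Matrix.specialUnitaryGroup (Fin 2) ℂ) := borel _
    haveI : BorelSpace (Matrix.specialUnitaryGroup (Fin 2) ℂ) := ⟨rfl⟩
    ∃ (r : LatticeRep (Matrix.specialUnitaryGroup (Fin 2) ℂ)) (a : ℝ → ℝ) (c₀ : ℝ), 0 < c₀ ∧ (∀ β, 0 < a β) ∧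
      Tendsto (fun β => a β / Transport.uRec β) atTop (𝓝 c₀) ∧
      (∃ (v : 𝓢(EuclideanSpace ℝ (Fin 4), ℝ)) (ε β₅ Λ₅ : ℝ),
        HasCompactSupport (v : EuclideanSpace ℝ (Fin 4) → ℝ) ∧
        tsupport (v : EuclideanSpace ℝ (Fin 4) → ℝ) ⊆ {y : EuclideanSpace ℝ (Fin 4) | 0 < y 0} ∧ 0 < ε ∧
        ∀ β : ℝ, β₅ ≤ β → ∀ L : ℕ, Λ₅ ≤ a β * L →
          ε ≤ Q2 (Matrix.specialUnitaryGroup (Fin 2) ℂ) r β L (a β) (thetaTest 4 v) v) ∧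
      (∃ (f g h : 𝓢(EuclideanSpace ℝ (Fin 4), ℝ)) (ε β₅ Λ₅ : ℝ),
        HasCompactSupport (f : EuclideanSpace ℝ (Fin 4) → ℝ) ∧
        HasCompactSupport (g : EuclideanSpace ℝ (Fin 4) → ℝ) ∧
        HasCompactSupport (h : EuclideanSpace ℝ (Fin 4) → ℝ) ∧
        Disjoint (tsupport (f : EuclideanSpace ℝ (Fin 4) → ℝ)) (tsupport (g : EuclideanSpace ℝ (Fin 4) → ℝ)) ∧
        Disjoint (tsupport (g : EuclideanSpace ℝ (Fin 4) → ℝ)) (tsupport (h : EuclideanSpace ℝ (Fin 4) → ℝ)) ∧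
        Disjoint (tsupport (f : EuclideanSpace ℝ (Fin 4) → ℝ)) (tsupport (h : EuclideanSpace ℝ (Fin 4) → ℝ)) ∧
        0 < ε ∧ ∀ β : ℝ, β₅ ≤ β → ∀ L : ℕ, Λ₅ ≤ a β * L →
          ε ≤ |Q3 (Matrix.specialUnitaryGroup (Fin 2) ℂ) r β L (a β) f g h|) := by
  letI : MeasurableSpace (Matrix.specialUnitaryGroup (Fin 2) ℂ) := borel _
  haveI : BorelSpace (Matrix.specialUnitaryGroup (Fin 2) ℂ) := ⟨rfl⟩
  obtain ⟨r, a, c₁, c₂, hc₁, hc₁₂, hapos, hwin, hFBL, hFC2, hFC3⟩ := hcfp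
  have hlim : Tendsto a atTop (𝓝 0) :=
    tendsto_zero_of_window hapos UnitTransfer.uRec_pos UnitTransfer.tendsto_uRec (hwin.mono fun β hβ => hβ.2)
  exact ⟨r, floorsEngine_of_fcp_commensurable r a hc₁ hc₁₂ hapos hlim hwin hFBL hFC2 hFC3⟩

/-- **The seam body at the unit of record from CFP6-type window data** (`SU(2)`, Borel): ONE lattice representation of
`SU(2)` with `FBL6 ∧ FC2 ∧ FC3` at a unit `a > 0`, `a → 0`, `c₁ ≤ a β / uRec β ≤ c₂` eventually (`0 < c₁ ≤ c₂`) ⇒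
`∃ r, LowerBounds SU(2) r uRec ∧ MomentBounds6 SU(2) r uRec` — the hypothesis of the proved D0 transport
`Transport.stub_transport_proved`. [folklore] -/
theorem uvSeamRecBody_of_cfp6Window
    (hcfp : letI : MeasurableSpace (Matrix.specialUnitaryGroup (Fin 2) ℂ) := borel _
      haveI : BorelSpace (Matrix.specialUnitaryGroup (Fin 2) ℂ) := ⟨rfl⟩
      ∃ (r : LatticeRep (Matrix.specialUnitaryGroup (Fin 2) ℂ)) (a : ℝ → ℝ) (c₁ c₂ : ℝ), 0 < c₁ ∧ c₁ ≤ c₂ ∧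
        (∀ β, 0 < a β) ∧ Tendsto a atTop (𝓝 0) ∧
        (∀ᶠ β in atTop, c₁ ≤ a β / Transport.uRec β ∧ a β / Transport.uRec β ≤ c₂) ∧
        FBL6 (Matrix.specialUnitaryGroup (Fin 2) ℂ) r a ∧ FC2 (Matrix.specialUnitaryGroup (Fin 2) ℂ) r a ∧
        FC3 (Matrix.specialUnitaryGroup (Fin 2) ℂ) r a) :
    letI : MeasurableSpace (Matrix.specialUnitaryGroup (Fin 2) ℂ) := borel _
    haveI : BorelSpace (Matrix.specialUnitaryGroup (Fin 2) ℂ) := ⟨rfl⟩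
    ∃ r : LatticeRep (Matrix.specialUnitaryGroup (Fin 2) ℂ),
      LowerBounds (Matrix.specialUnitaryGroup (Fin 2) ℂ) r Transport.uRec ∧
        MomentBounds6 (Matrix.specialUnitaryGroup (Fin 2) ℂ) r Transport.uRec := by
  letI : MeasurableSpace (Matrix.specialUnitaryGroup (Fin 2) ℂ) := borel _
  haveI : BorelSpace (Matrix.specialUnitaryGroup (Fin 2) ℂ) := ⟨rfl⟩
  obtain ⟨r, a, c₁, c₂, hc₁, hc₁₂, hapos, hlim, hwin, hFBL6, hFC2, hFC3⟩ := hcfp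
  exact ⟨r, seamLegs_uRec_of_cfp6_commensurable r a hc₁ hc₁₂ hapos hlim hwin hFBL6 hFC2 hFC3⟩

/-- **`UVSeamRec` from CFP6-type window data at `SU(2)` — its `UV` hypothesis UNUSED.**  ONE lattice representation of
`SU(2)` with `FBL6 ∧ FC2 ∧ FC3` at a unit commensurate with `uRec` gives the route decl
`…Theses.BalabanLadder.UVSeamRec` for every compact simple `G ≃ₜ* SU(2)` through the proved D0 transport; neither `UV`
nor `IsCompactSimpleLieGroup SU(2)` is consumed (the femto discharge path of the seam, re-based on conditional-package
data). [folklore] -/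
theorem uvSeamRec_of_cfp6Window
    (hcfp : letI : MeasurableSpace (Matrix.specialUnitaryGroup (Fin 2) ℂ) := borel _
      haveI : BorelSpace (Matrix.specialUnitaryGroup (Fin 2) ℂ) := ⟨rfl⟩
      ∃ (r : LatticeRep (Matrix.specialUnitaryGroup (Fin 2) ℂ)) (a : ℝ → ℝ) (c₁ c₂ : ℝ), 0 < c₁ ∧ c₁ ≤ c₂ ∧
        (∀ β, 0 < a β) ∧ Tendsto a atTop (𝓝 0) ∧
        (∀ᶠ β in atTop, c₁ ≤ a β / Transport.uRec β ∧ a β / Transport.uRec β ≤ c₂) ∧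
        FBL6 (Matrix.specialUnitaryGroup (Fin 2) ℂ) r a ∧ FC2 (Matrix.specialUnitaryGroup (Fin 2) ℂ) r a ∧
        FC3 (Matrix.specialUnitaryGroup (Fin 2) ℂ) r a) :
    Summit.QuantumFields.YangMills.Theses.BalabanLadder.UVSeamRec := by
  intro _hUV G _ _ _ _ hG hne
  exact Transport.stub_transport_proved (uvSeamRecBody_of_cfp6Window hcfp) G hG hne

/-- **ENGINE-AGNOSTIC form of the check-lemma: the REGISTERED `stub_floorsEngine` statement from a compact scale-window
engine.**  ONE lattice representation of `SU(2)` whose compactly supported witnesses floor `Q2(θv, v)` / `|Q3(f, g, h)|` at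
every smearing scale `a β / s`, `s ∈ [s₁, s₂]` (`0 < s₁`), at an engine unit `a` with `s₁ ≤ a β / uRec β ≤ s₂` eventually
(= the `heng` binder of the landed `WindowTransfer.stubFloors_of_windowEngine` with the compact support of the witnesses
RECORDED) ⇒ the registered `stub_floorsEngine` statement verbatim, with witnesses `(r, uRec, c₀ := 1)`
(`floorsC_of_window` with `u := uRec`).  So the reserve cut (ω) feeds the registered cut (α) for every engine, not only
for the femto package. [folklore] -/
theorem stubFloorsEngine_of_windowEngineC
    (heng : letI : MeasurableSpace (Matrix.specialUnitaryGroup (Fin 2) ℂ) := borel _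
      haveI : BorelSpace (Matrix.specialUnitaryGroup (Fin 2) ℂ) := ⟨rfl⟩
      ∃ (r : LatticeRep (Matrix.specialUnitaryGroup (Fin 2) ℂ)) (a : ℝ → ℝ) (s₁ s₂ : ℝ), 0 < s₁ ∧
        (∀ᶠ β in atTop, s₁ ≤ a β / Transport.uRec β ∧ a β / Transport.uRec β ≤ s₂) ∧
        (∃ (v : 𝓢(EuclideanSpace ℝ (Fin 4), ℝ)) (ε β₅ Λ₅ : ℝ),
          HasCompactSupport (v : EuclideanSpace ℝ (Fin 4) → ℝ) ∧
          tsupport (v : EuclideanSpace ℝ (Fin 4) → ℝ) ⊆ {y : EuclideanSpace ℝ (Fin 4) | 0 < y 0} ∧ 0 < ε ∧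
          ∀ s ∈ Set.Icc s₁ s₂, ∀ β : ℝ, β₅ ≤ β → ∀ L : ℕ, Λ₅ ≤ a β * L →
            ε ≤ Q2 (Matrix.specialUnitaryGroup (Fin 2) ℂ) r β L (a β / s) (thetaTest 4 v) v) ∧
        (∃ (f g h : 𝓢(EuclideanSpace ℝ (Fin 4), ℝ)) (ε β₅ Λ₅ : ℝ),
          HasCompactSupport (f : EuclideanSpace ℝ (Fin 4) → ℝ) ∧
          HasCompactSupport (g : EuclideanSpace ℝ (Fin 4) → ℝ) ∧
          HasCompactSupport (h : EuclideanSpace ℝ (Fin 4) → ℝ) ∧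
          Disjoint (tsupport (f : EuclideanSpace ℝ (Fin 4) → ℝ)) (tsupport (g : EuclideanSpace ℝ (Fin 4) → ℝ)) ∧
          Disjoint (tsupport (g : EuclideanSpace ℝ (Fin 4) → ℝ)) (tsupport (h : EuclideanSpace ℝ (Fin 4) → ℝ)) ∧
          Disjoint (tsupport (f : EuclideanSpace ℝ (Fin 4) → ℝ)) (tsupport (h : EuclideanSpace ℝ (Fin 4) → ℝ)) ∧ 0 < ε ∧
          ∀ s ∈ Set.Icc s₁ s₂, ∀ β : ℝ, β₅ ≤ β → ∀ L : ℕ, Λ₅ ≤ a β * L →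
            ε ≤ |Q3 (Matrix.specialUnitaryGroup (Fin 2) ℂ) r β L (a β / s) f g h|)) :
    letI : MeasurableSpace (Matrix.specialUnitaryGroup (Fin 2) ℂ) := borel _
    haveI : BorelSpace (Matrix.specialUnitaryGroup (Fin 2) ℂ) := ⟨rfl⟩
    ∃ (r : LatticeRep (Matrix.specialUnitaryGroup (Fin 2) ℂ)) (a : ℝ → ℝ) (c₀ : ℝ), 0 < c₀ ∧ (∀ β, 0 < a β) ∧
      Tendsto (fun β => a β / Transport.uRec β) atTop (𝓝 c₀) ∧
      (∃ (v : 𝓢(EuclideanSpace ℝ (Fin 4), ℝ)) (ε β₅ Λ₅ : ℝ),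
        HasCompactSupport (v : EuclideanSpace ℝ (Fin 4) → ℝ) ∧
        tsupport (v : EuclideanSpace ℝ (Fin 4) → ℝ) ⊆ {y : EuclideanSpace ℝ (Fin 4) | 0 < y 0} ∧ 0 < ε ∧
        ∀ β : ℝ, β₅ ≤ β → ∀ L : ℕ, Λ₅ ≤ a β * L →
          ε ≤ Q2 (Matrix.specialUnitaryGroup (Fin 2) ℂ) r β L (a β) (thetaTest 4 v) v) ∧
      (∃ (f g h : 𝓢(EuclideanSpace ℝ (Fin 4), ℝ)) (ε β₅ Λ₅ : ℝ),
        HasCompactSupport (f : EuclideanSpace ℝ (Fin 4) → ℝ) ∧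
        HasCompactSupport (g : EuclideanSpace ℝ (Fin 4) → ℝ) ∧
        HasCompactSupport (h : EuclideanSpace ℝ (Fin 4) → ℝ) ∧
        Disjoint (tsupport (f : EuclideanSpace ℝ (Fin 4) → ℝ)) (tsupport (g : EuclideanSpace ℝ (Fin 4) → ℝ)) ∧
        Disjoint (tsupport (g : EuclideanSpace ℝ (Fin 4) → ℝ)) (tsupport (h : EuclideanSpace ℝ (Fin 4) → ℝ)) ∧
        Disjoint (tsupport (f : EuclideanSpace ℝ (Fin 4) → ℝ)) (tsupport (h : EuclideanSpace ℝ (Fin 4) → ℝ)) ∧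
        0 < ε ∧ ∀ β : ℝ, β₅ ≤ β → ∀ L : ℕ, Λ₅ ≤ a β * L →
          ε ≤ |Q3 (Matrix.specialUnitaryGroup (Fin 2) ℂ) r β L (a β) f g h|) := by
  letI : MeasurableSpace (Matrix.specialUnitaryGroup (Fin 2) ℂ) := borel _
  haveI : BorelSpace (Matrix.specialUnitaryGroup (Fin 2) ℂ) := ⟨rfl⟩
  obtain ⟨r, a, s₁, s₂, hs₁, hwin, h2, h3⟩ := heng
  obtain ⟨h2', h3'⟩ := floorsC_of_window r hs₁ UnitTransfer.uRec_pos hwin h2 h3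
  refine ⟨r, Transport.uRec, 1, one_pos, UnitTransfer.uRec_pos, ?_, h2', h3'⟩
  exact tendsto_const_nhds.congr' (Filter.Eventually.of_forall fun β => (div_self (UnitTransfer.uRec_pos β).ne').symm)

end Summit.QuantumFields.YangMills.Cruxes.UVSeamRec.FloorsEngineOfWindow

end
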